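import Literature.Geometry.Lorentzian.BogovskiiWeightDeriv
import Literature.Geometry.Lorentzian.BogovskiiOperator
import Mathlib.MeasureTheory.Group.Integral
import HarnessLib

/-!
# Regularity of the Bogovskiĭ-type operator `S` in `x`

(trunk G08 = T-LORENTZ; family `gr`; namespace `Literature.Geometry.Lorentzian.MaoOhTao`.)

Mao–Oh–Tao (arXiv:2308.13031), Lemma 2.3: `(S_η f)^{ij}(x) = ∫ Ψ^{ij}_η(x, y) f(y) dy` with
`Ψ^{ij}_η(z + y, y) = w_y(|z|, z/|z|) zⁱzʲ/|z|³`.  In the translated form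
`(S_η f)(x) = ∫ w_{x−z}(|z|, z/|z|) zᵢzⱼ/|z|³ f(x − z) dz` (`bogovskiiOperator_eq_translated`) all the `x`-dependence
sits in the base point of the weight and in `f`, and the kernel singularity `~ 1/|z|` is integrable; hence, by
dominated convergence and differentiation under the integral sign (the base-point derivative of the weight is the
weight of `Dη`, `BogovskiiWeightDeriv.lean`):

* `continuous_bogovskiiOperator` — `S_η g` is continuous for `η, g ∈ C_c`;
* `hasFDerivAt_bogovskiiOperator`, `differentiable_bogovskiiOperator`, `contDiff_one_bogovskiiOperator` —
  `S_η f ∈ C¹` for `η, f ∈ C¹_c`, with the derivative under the integral sign;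
* `pd_bogovskiiOperator` — **`∂_m (S_η f)^{ij} = (S_{∂_mη} f)^{ij} + (S_η ∂_m f)^{ij}`**: the derivative falls on the
  cut-off (the same operator with cut-off `∂_mη`, one degree of regularity of `η` consumed) and on `f`.

Iterating, `S_η f ∈ C^k` for `η, f ∈ C^k_c`; this is the classical (pointwise) regularity behind the weak identities
of `BogovskiiOperator.lean`, and the structure `∂S_η = S_{∂η} + S_η∂` is the one exploited in the commutator /
ΨDO description of `S` in the paper (proof of Lemma 2.3, (S3)–(S4)).

Everything is proved; no definitions, no named facts.

## References

* Y. Mao, S.-J. Oh, T. Tao, arXiv:2308.13031 (2023), Lemma 2.3, p. 8 (key `MaoOhTao2023`).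
-/

noncomputable section

open scoped RealInnerProductSpace Topology
open Filter MeasureTheory Set Metric Function

namespace Literature.Geometry.Lorentzian

namespace MaoOhTao

variable {η : E3 → ℝ} {R : ℝ}

/-! ### Regularity of the operator `S` in `x` -/

section Regularity

variable {f : E3 → ℝ}

/-- `|zᵢ zⱼ/|z|³| ≤ 1/|z|`. [folklore] -/
theorem abs_kernel_le_inv_norm (z : E3) (i j : Fin 3) : |z i * (z j * (‖z‖ ^ 3)⁻¹)| ≤ ‖z‖⁻¹ := by
  by_cases hz : z = 0
  · subst hz; simp
  have hn : 0 < ‖z‖ := norm_pos_iff.2 hz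
  have hi : |z i| ≤ ‖z‖ := by simpa using PiLp.norm_apply_le z i
  have hj : |z j| ≤ ‖z‖ := by simpa using PiLp.norm_apply_le z j
  rw [abs_mul, abs_mul, abs_inv, abs_pow, abs_norm]
  calc |z i| * (|z j| * (‖z‖ ^ 3)⁻¹) ≤ ‖z‖ * (‖z‖ * (‖z‖ ^ 3)⁻¹) :=
        mul_le_mul hi (mul_le_mul_of_nonneg_right hj (by positivity)) (by positivity) (norm_nonneg _)
    _ = ‖z‖⁻¹ := by field_simp

/-- The dominating function `C 𝟙_{B̄_D}(z)/|z|` is integrable on `ℝ³`. [folklore] -/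
theorem integrable_indicator_inv_norm (C D : ℝ) :
    Integrable fun z : E3 ↦ (closedBall (0 : E3) D).indicator (fun z ↦ C * ‖z‖⁻¹) z := by
  refine (integrable_indicator_iff measurableSet_closedBall).2 ?_
  have h : IntegrableOn (fun z : E3 ↦ ‖z‖⁻¹) (ball (0 : E3) (|D| + 1)) :=
    integrableOn_ball_of_norm_le_rpow (by rw [finrank_euclideanSpace_fin]; norm_num) (C := 1) (α := 1)
      (by rw [finrank_euclideanSpace_fin]; norm_num)
      (Eventually.of_forall fun z ↦ by rw [Real.rpow_neg (norm_nonneg _), Real.rpow_one, one_mul, norm_inv, norm_norm])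
      (continuous_norm.measurable.inv.aestronglyMeasurable)
  exact (h.mono_set (closedBall_subset_ball (by linarith [le_abs_self D]))).const_mul C

/-- The weight is continuous in the base point (for continuous `η`). [folklore] -/
theorem continuous_bogovskiiWeight_base (hη : Continuous η) (hR : ∀ z : E3, R < ‖z‖ → η z = 0) {α : E3}
    (hα : ‖α‖ = 1) (r : ℝ) : Continuous fun y : E3 ↦ bogovskiiWeight η y r α := by
  have h := (continuousOn_bogovskiiWeight_param hη hR).comp_continuous
    (continuous_id.prodMk (continuous_const.prodMk continuous_const) :
      Continuous fun y : E3 ↦ (y, r, α))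
    (fun y ↦ ⟨mem_univ _, mem_univ _, mem_sphere_zero_iff_norm.2 hα⟩)
  exact h

/-- The derivative weight is continuous in the base point. [folklore] -/
theorem continuous_fderivWeight_base (hη : ContDiff ℝ 1 η) (hR : ∀ z : E3, R < ‖z‖ → η z = 0) {α : E3}
    (hα : ‖α‖ = 1) (r : ℝ) : Continuous fun y : E3 ↦ ∫ s in Ioi r, (s ^ 2) • fderiv ℝ η (s • α + y) := by
  have h := (continuousOn_fderivWeight_param hη hR).comp_continuous
    (continuous_id.prodMk (continuous_const.prodMk continuous_const) :
      Continuous fun y : E3 ↦ (y, r, α))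
    (fun y ↦ ⟨mem_univ _, mem_univ _, mem_sphere_zero_iff_norm.2 hα⟩)
  exact h

/-- The translated weight `z ↦ w_{x−z}(|z|, z/|z|)` is continuous off `z = 0`. [folklore] -/
theorem continuousOn_weight_translated (hη : Continuous η) (hR : ∀ z : E3, R < ‖z‖ → η z = 0) (x : E3) :
    ContinuousOn (fun z : E3 ↦ bogovskiiWeight η (x - z) ‖z‖ (‖z‖⁻¹ • z)) {0}ᶜ := by
  have h := (continuousOn_bogovskiiWeight_sub hη hR).comp
    (continuous_const.prodMk (continuous_const.sub continuous_id)).continuousOn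
    (fun z (hz : z ∈ ({0}ᶜ : Set E3)) ↦ show (x, x - z).1 ≠ (x, x - z).2 from fun h ↦
      hz (by rw [mem_singleton_iff]; exact sub_eq_self.1 h.symm))
  refine h.congr fun z _ ↦ ?_
  simp only [Function.comp_apply, Pi.sub_apply, id_eq, sub_sub_cancel]

/-- The translated derivative weight `z ↦ D_y w_{x−z}(|z|, z/|z|)` is continuous off `z = 0`. [folklore] -/
theorem continuousOn_fderivWeight_translated (hη : ContDiff ℝ 1 η) (hR : ∀ z : E3, R < ‖z‖ → η z = 0)
    (x : E3) :
    ContinuousOn (fun z : E3 ↦ ∫ s in Ioi ‖z‖, (s ^ 2) • fderiv ℝ η (s • (‖z‖⁻¹ • z) + (x - z))) {0}ᶜ := by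
  have h := (continuousOn_fderivWeight_sub hη hR).comp
    (continuous_const.prodMk (continuous_const.sub continuous_id)).continuousOn
    (fun z (hz : z ∈ ({0}ᶜ : Set E3)) ↦ show (x, x - z).1 ≠ (x, x - z).2 from fun h ↦
      hz (by rw [mem_singleton_iff]; exact sub_eq_self.1 h.symm))
  refine h.congr fun z _ ↦ ?_
  simp only [Function.comp_apply, Pi.sub_apply, id_eq, sub_sub_cancel]

/-- The kernel `zᵢzⱼ/|z|³` is continuous off `z = 0`. [folklore] -/
theorem continuousOn_kernel (i j : Fin 3) : ContinuousOn (fun z : E3 ↦ z i * (z j * (‖z‖ ^ 3)⁻¹)) {0}ᶜ :=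
  (EuclideanSpace.proj (𝕜 := ℝ) i).continuous.continuousOn.mul
    ((EuclideanSpace.proj (𝕜 := ℝ) j).continuous.continuousOn.mul
      (ContinuousOn.inv₀ (continuous_norm.pow 3).continuousOn fun _ hz ↦
        pow_ne_zero 3 (norm_ne_zero_iff.2 (mem_compl_singleton_iff.1 hz))))

/-- A function continuous off the origin of `ℝ³` is a.e.-strongly measurable. [folklore] -/
theorem aestronglyMeasurable_of_continuousOn_compl_zero {X : Type*} [TopologicalSpace X]
    [TopologicalSpace.PseudoMetrizableSpace X] {g : E3 → X} (hg : ContinuousOn g {0}ᶜ) :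
    AEStronglyMeasurable g (volume : Measure E3) := by
  have h := hg.aestronglyMeasurable (μ := (volume : Measure E3)) (measurableSet_singleton (0 : E3)).compl
  rwa [restrict_compl_singleton] at h

/-- `{0}ᶜ` has full measure. [folklore] -/
theorem compl_zero_mem_ae : ({0}ᶜ : Set E3) ∈ ae (volume : Measure E3) :=
  compl_mem_ae_iff.2 (measure_singleton 0)

/-- **The operator in translated form**: `(S_η g)^{ij}(x) = ∫ w_{x−z}(|z|, z/|z|) zᵢzⱼ/|z|³ g(x − z) dz`. [folklore] -/
theorem bogovskiiOperator_eq_translated (η g : E3 → ℝ) (x : E3) (i j : Fin 3) :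
    ∫ y : E3, bogovskiiWeight η y ‖x - y‖ (‖x - y‖⁻¹ • (x - y)) * ((x - y) i * ((x - y) j * (‖x - y‖ ^ 3)⁻¹)) * g y =
      ∫ z : E3, bogovskiiWeight η (x - z) ‖z‖ (‖z‖⁻¹ • z) * (z i * (z j * (‖z‖ ^ 3)⁻¹)) * g (x - z) := by
  rw [← integral_sub_left_eq_self (fun y : E3 ↦ bogovskiiWeight η y ‖x - y‖ (‖x - y‖⁻¹ • (x - y)) *
    ((x - y) i * ((x - y) j * (‖x - y‖ ^ 3)⁻¹)) * g y) volume x]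
  refine integral_congr_ae (ae_of_all _ fun z ↦ ?_)
  simp only [sub_sub_cancel]

/-- If `|x − z| ≤ Rg` and `|x| ≤ X` then `|z| ≤ X + Rg`. [folklore] -/
theorem mem_closedBall_of_norm_sub_le {x z : E3} {X Rg : ℝ} (hx : ‖x‖ ≤ X) (hy : ‖x - z‖ ≤ Rg) :
    z ∈ closedBall (0 : E3) (X + Rg) := by
  rw [mem_closedBall, dist_zero_right]
  have : ‖z‖ ≤ ‖x‖ + ‖x - z‖ := by
    calc ‖z‖ = ‖x - (x - z)‖ := by rw [sub_sub_cancel]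
      _ ≤ ‖x‖ + ‖x - z‖ := norm_sub_le _ _
  linarith

/-- **Pointwise bound for the translated integrand**: for `|x| ≤ X`, `g` vanishing off `B̄_{Rg}` with `|g| ≤ Mg`, and a
weight bound `W` valid for base points of norm `≤ Rg`: `|w_{x−z} zᵢzⱼ/|z|³ g(x − z)| ≤ W Mg 𝟙_{|z| ≤ X + Rg}/|z|`.
[folklore] -/
theorem abs_translated_le (η : E3 → ℝ) {W Rg Mg X : ℝ} (hW0 : 0 ≤ W)
    (hW : ∀ y : E3, ‖y‖ ≤ Rg → ∀ (r : ℝ) (α : E3), ‖α‖ = 1 → |bogovskiiWeight η y r α| ≤ W)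
    {g : E3 → ℝ} (hgR : ∀ y, g y ≠ 0 → ‖y‖ ≤ Rg) (hgM : ∀ y, |g y| ≤ Mg) {x : E3} (hx : ‖x‖ ≤ X) (z : E3)
    (i j : Fin 3) :
    |bogovskiiWeight η (x - z) ‖z‖ (‖z‖⁻¹ • z) * (z i * (z j * (‖z‖ ^ 3)⁻¹)) * g (x - z)| ≤
      (closedBall (0 : E3) (X + Rg)).indicator (fun z ↦ W * Mg * ‖z‖⁻¹) z := by
  have hMg : 0 ≤ Mg := (abs_nonneg _).trans (hgM 0)
  by_cases hg0 : g (x - z) = 0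
  · rw [hg0, mul_zero, abs_zero]
    exact indicator_nonneg (fun z _ ↦ by positivity) _
  rw [indicator_of_mem (mem_closedBall_of_norm_sub_le hx (hgR _ hg0))]
  by_cases hz : z = 0
  · subst hz; simp
  have hn : 0 < ‖z‖ := norm_pos_iff.2 hz
  have hw : |bogovskiiWeight η (x - z) ‖z‖ (‖z‖⁻¹ • z)| ≤ W :=
    hW _ (hgR _ hg0) _ _ (by rw [norm_smul, norm_inv, norm_norm, inv_mul_cancel₀ hn.ne'])
  rw [abs_mul, abs_mul]
  calc |bogovskiiWeight η (x - z) ‖z‖ (‖z‖⁻¹ • z)| * |z i * (z j * (‖z‖ ^ 3)⁻¹)| * |g (x - z)|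
      ≤ W * ‖z‖⁻¹ * Mg := mul_le_mul (mul_le_mul hw (abs_kernel_le_inv_norm z i j) (abs_nonneg _) hW0)
        (hgM _) (abs_nonneg _) (by positivity)
    _ = W * Mg * ‖z‖⁻¹ := by ring

/-- Support radius and sup bound of a continuous compactly supported function. [folklore] -/
theorem exists_radius_bound {g : E3 → ℝ} (hg : Continuous g) (hgc : HasCompactSupport g) :
    ∃ Rg Mg : ℝ, (∀ y, g y ≠ 0 → ‖y‖ ≤ Rg) ∧ (tsupport g ⊆ closedBall 0 Rg) ∧ ∀ y, |g y| ≤ Mg := by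
  obtain ⟨Rg, hRg⟩ := hgc.isCompact.isBounded.subset_closedBall 0
  obtain ⟨Mg, hMg⟩ := hg.bounded_above_of_compact_support hgc
  refine ⟨Rg, Mg, fun y hy ↦ ?_, hRg, fun y ↦ (Real.norm_eq_abs _).symm.le.trans (hMg y)⟩
  have := hRg (subset_tsupport _ (mem_support.2 hy))
  rwa [mem_closedBall, dist_zero_right] at this

/-- The translated integrand is integrable (for `η, g ∈ C_c`). [folklore] -/
theorem integrable_translated (hη : Continuous η) (hR : ∀ z : E3, R < ‖z‖ → η z = 0) {g : E3 → ℝ}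
    (hg : Continuous g) (hgc : HasCompactSupport g) (x : E3) (i j : Fin 3) :
    Integrable fun z : E3 ↦ bogovskiiWeight η (x - z) ‖z‖ (‖z‖⁻¹ • z) * (z i * (z j * (‖z‖ ^ 3)⁻¹)) * g (x - z) := by
  obtain ⟨Rg, Mg, hgR, -, hgM⟩ := exists_radius_bound hg hgc
  obtain ⟨W, hW⟩ := exists_abs_bogovskiiWeight_le_of_norm_le hη hR Rg
  refine (integrable_indicator_inv_norm (max W 0 * Mg) (‖x‖ + Rg)).mono'
    (aestronglyMeasurable_of_continuousOn_compl_zero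
      (((continuousOn_weight_translated hη hR x).mul (continuousOn_kernel i j)).mul
        ((hg.comp (continuous_const.sub continuous_id)).continuousOn))) (ae_of_all _ fun z ↦ ?_)
  rw [Real.norm_eq_abs]
  exact abs_translated_le η (le_max_right _ _) (fun y hy r α hα ↦ (hW y hy r α hα).trans (le_max_left _ _))
    hgR hgM le_rfl z i j

/-- **`S_η g` is continuous** for `η, g ∈ C_c` (dominated convergence in the translated form).
[cite: MaoOhTao2023, Lemma 2.3] -/
theorem continuous_bogovskiiOperator (hη : Continuous η) (hR : ∀ z : E3, R < ‖z‖ → η z = 0) {g : E3 → ℝ}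
    (hg : Continuous g) (hgc : HasCompactSupport g) (i j : Fin 3) :
    Continuous fun x : E3 ↦ ∫ y : E3, bogovskiiWeight η y ‖x - y‖ (‖x - y‖⁻¹ • (x - y)) *
      ((x - y) i * ((x - y) j * (‖x - y‖ ^ 3)⁻¹)) * g y := by
  simp only [bogovskiiOperator_eq_translated]
  obtain ⟨Rg, Mg, hgR, -, hgM⟩ := exists_radius_bound hg hgc
  obtain ⟨W, hW⟩ := exists_abs_bogovskiiWeight_le_of_norm_le hη hR Rg
  refine continuous_iff_continuousAt.2 fun x₀ ↦ ?_
  refine continuousAt_of_dominated (bound := fun z ↦ (closedBall (0 : E3) (‖x₀‖ + 1 + Rg)).indicator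
    (fun z ↦ max W 0 * Mg * ‖z‖⁻¹) z) ?_ ?_ (integrable_indicator_inv_norm _ _) ?_
  · exact Eventually.of_forall fun x ↦ aestronglyMeasurable_of_continuousOn_compl_zero
      (((continuousOn_weight_translated hη hR x).mul (continuousOn_kernel i j)).mul
        ((hg.comp (continuous_const.sub continuous_id)).continuousOn))
  · filter_upwards [Metric.ball_mem_nhds x₀ one_pos] with x hx
    refine ae_of_all _ fun z ↦ ?_
    rw [Real.norm_eq_abs]
    refine abs_translated_le η (le_max_right _ _) (fun y hy r α hα ↦ (hW y hy r α hα).trans (le_max_left _ _))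
      hgR hgM ?_ z i j
    rw [mem_ball, dist_eq_norm] at hx
    have := norm_le_insert' x x₀
    linarith
  · filter_upwards [compl_zero_mem_ae] with z hz
    have hn : 0 < ‖z‖ := norm_pos_iff.2 (mem_compl_singleton_iff.1 hz)
    have hα : ‖‖z‖⁻¹ • z‖ = 1 := by rw [norm_smul, norm_inv, norm_norm, inv_mul_cancel₀ hn.ne']
    exact ((((continuous_bogovskiiWeight_base hη hR hα ‖z‖).comp (continuous_id.sub continuous_const)).mul
      continuous_const).mul (hg.comp (continuous_id.sub continuous_const))).continuousAt

/-- `(D_y w_y(r, α)) e_m = w^{(∂_mη)}_y(r, α)`. [folklore] -/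
theorem fderivWeight_apply_e (hη : ContDiff ℝ 1 η) (hR : ∀ z : E3, R < ‖z‖ → η z = 0) {α : E3} (hα : ‖α‖ = 1)
    (r : ℝ) (y : E3) (m : Fin 3) :
    (∫ s in Ioi r, (s ^ 2) • fderiv ℝ η (s • α + y)) (e m) = bogovskiiWeight (pd m η) y r α := by
  rw [← (hasFDerivAt_bogovskiiWeight_base hη hR hα r y).fderiv]
  exact fderiv_bogovskiiWeight_base_apply hη hR hα r y m

/-- **Bound for the derivative integrand** `zᵢzⱼ/|z|³ (w_{x−z} Df(x − z) + f(x − z) D_y w_{x−z})`, uniformly over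
`|x| ≤ X`: `≤ C 𝟙_{|z| ≤ D}/|z|`. [folklore] -/
theorem exists_norm_derivIntegrand_le (hη : ContDiff ℝ 1 η) (hR : ∀ z : E3, R < ‖z‖ → η z = 0)
    (hf : ContDiff ℝ 1 f) (hfc : HasCompactSupport f) (i j : Fin 3) (X : ℝ) :
    ∃ C D : ℝ, 0 ≤ C ∧ ∀ x : E3, ‖x‖ ≤ X → ∀ z : E3,
      ‖(z i * (z j * (‖z‖ ^ 3)⁻¹)) • (bogovskiiWeight η (x - z) ‖z‖ (‖z‖⁻¹ • z) • fderiv ℝ f (x - z) +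
          f (x - z) • ∫ s in Ioi ‖z‖, (s ^ 2) • fderiv ℝ η (s • (‖z‖⁻¹ • z) + (x - z)))‖ ≤
        (closedBall (0 : E3) D).indicator (fun z ↦ C * ‖z‖⁻¹) z := by
  have hηc : Continuous η := hη.continuous
  have hfcn : Continuous f := hf.continuous
  have hdf : Continuous (fderiv ℝ f) := hf.continuous_fderiv one_ne_zero
  obtain ⟨Rf, Mf, hfR, hts, hfM⟩ := exists_radius_bound hfcn hfc
  obtain ⟨Mdf, hMdf⟩ := hdf.bounded_above_of_compact_support (hfc.fderiv (𝕜 := ℝ))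
  obtain ⟨W, hW⟩ := exists_abs_bogovskiiWeight_le_of_norm_le hηc hR Rf
  obtain ⟨W', hW'⟩ := exists_norm_fderivWeight_le_of_norm_le hη hR Rf
  have hMf0 : 0 ≤ Mf := (abs_nonneg _).trans (hfM 0)
  have hMdf0 : 0 ≤ Mdf := (norm_nonneg _).trans (hMdf 0)
  have hdfR : ∀ y, fderiv ℝ f y ≠ 0 → ‖y‖ ≤ Rf := fun y hy ↦ by
    have := hts (support_fderiv_subset ℝ (mem_support.2 hy))
    rwa [mem_closedBall, dist_zero_right] at this
  refine ⟨max W 0 * Mdf + Mf * max W' 0, X + Rf, by positivity, fun x hxX z ↦ ?_⟩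
  by_cases h0 : f (x - z) = 0 ∧ fderiv ℝ f (x - z) = 0
  · rw [h0.1, h0.2, smul_zero, zero_smul, add_zero, smul_zero, norm_zero]
    exact indicator_nonneg (fun z _ ↦ by positivity) _
  have hy : ‖x - z‖ ≤ Rf := by
    rcases not_and_or.1 h0 with h1 | h1
    · exact hfR _ h1
    · exact hdfR _ h1
  rw [indicator_of_mem (mem_closedBall_of_norm_sub_le hxX hy)]
  by_cases hz : z = 0
  · subst hz
    simp only [PiLp.zero_apply, zero_mul, zero_smul, norm_zero]
    positivity
  have hn : 0 < ‖z‖ := norm_pos_iff.2 hz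
  have hα : ‖‖z‖⁻¹ • z‖ = 1 := by rw [norm_smul, norm_inv, norm_norm, inv_mul_cancel₀ hn.ne']
  have hw : |bogovskiiWeight η (x - z) ‖z‖ (‖z‖⁻¹ • z)| ≤ max W 0 := (hW _ hy _ _ hα).trans (le_max_left _ _)
  have hw' : ‖∫ s in Ioi ‖z‖, (s ^ 2) • fderiv ℝ η (s • (‖z‖⁻¹ • z) + (x - z))‖ ≤ max W' 0 :=
    (hW' _ hy _ _ hα).trans (le_max_left _ _)
  rw [norm_smul, Real.norm_eq_abs]
  calc |z i * (z j * (‖z‖ ^ 3)⁻¹)| * ‖bogovskiiWeight η (x - z) ‖z‖ (‖z‖⁻¹ • z) • fderiv ℝ f (x - z) +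
          f (x - z) • ∫ s in Ioi ‖z‖, (s ^ 2) • fderiv ℝ η (s • (‖z‖⁻¹ • z) + (x - z))‖
      ≤ ‖z‖⁻¹ * (max W 0 * Mdf + Mf * max W' 0) := by
        refine mul_le_mul (abs_kernel_le_inv_norm z i j) ((norm_add_le _ _).trans (add_le_add ?_ ?_))
          (norm_nonneg _) (by positivity)
        · rw [norm_smul, Real.norm_eq_abs]
          exact mul_le_mul hw (hMdf _) (norm_nonneg _) (le_max_right _ _)
        · rw [norm_smul, Real.norm_eq_abs]
          exact mul_le_mul (hfM _) hw' (norm_nonneg _) hMf0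
    _ = (max W 0 * Mdf + Mf * max W' 0) * ‖z‖⁻¹ := by ring

/-- The derivative integrand is continuous in `z` off `z = 0` (hence a.e.-strongly measurable). [folklore] -/
theorem continuousOn_derivIntegrand (hη : ContDiff ℝ 1 η) (hR : ∀ z : E3, R < ‖z‖ → η z = 0)
    (hf : ContDiff ℝ 1 f) (i j : Fin 3) (x : E3) :
    ContinuousOn (fun z : E3 ↦ (z i * (z j * (‖z‖ ^ 3)⁻¹)) •
      (bogovskiiWeight η (x - z) ‖z‖ (‖z‖⁻¹ • z) • fderiv ℝ f (x - z) +
        f (x - z) • ∫ s in Ioi ‖z‖, (s ^ 2) • fderiv ℝ η (s • (‖z‖⁻¹ • z) + (x - z)))) {0}ᶜ :=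
  (continuousOn_kernel i j).smul (((continuousOn_weight_translated hη.continuous hR x).smul
    (((hf.continuous_fderiv one_ne_zero).comp (continuous_const.sub continuous_id)).continuousOn)).add
    (((hf.continuous.comp (continuous_const.sub continuous_id)).continuousOn).smul
      (continuousOn_fderivWeight_translated hη hR x)))

/-- The derivative integrand is continuous in `x` for `z ≠ 0`. [folklore] -/
theorem continuous_derivIntegrand_base (hη : ContDiff ℝ 1 η) (hR : ∀ z : E3, R < ‖z‖ → η z = 0)
    (hf : ContDiff ℝ 1 f) (i j : Fin 3) {z : E3} (hz : z ≠ 0) :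
    Continuous (fun x : E3 ↦ (z i * (z j * (‖z‖ ^ 3)⁻¹)) •
      (bogovskiiWeight η (x - z) ‖z‖ (‖z‖⁻¹ • z) • fderiv ℝ f (x - z) +
        f (x - z) • ∫ s in Ioi ‖z‖, (s ^ 2) • fderiv ℝ η (s • (‖z‖⁻¹ • z) + (x - z)))) := by
  have hn : 0 < ‖z‖ := norm_pos_iff.2 hz
  have hα : ‖‖z‖⁻¹ • z‖ = 1 := by rw [norm_smul, norm_inv, norm_norm, inv_mul_cancel₀ hn.ne']
  have hs : Continuous fun x : E3 ↦ x - z := continuous_id.sub continuous_const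
  have hin : Continuous fun x : E3 ↦ bogovskiiWeight η (x - z) ‖z‖ (‖z‖⁻¹ • z) • fderiv ℝ f (x - z) +
      f (x - z) • ∫ s in Ioi ‖z‖, (s ^ 2) • fderiv ℝ η (s • (‖z‖⁻¹ • z) + (x - z)) :=
    (((continuous_bogovskiiWeight_base hη.continuous hR hα ‖z‖).comp hs).smul
      ((hf.continuous_fderiv one_ne_zero).comp hs)).add ((hf.continuous.comp hs).smul
        ((continuous_fderivWeight_base hη hR hα ‖z‖).comp hs))
  exact hin.const_smul (z i * (z j * (‖z‖ ^ 3)⁻¹))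

/-- The derivative integrand is integrable. [folklore] -/
theorem integrable_derivIntegrand (hη : ContDiff ℝ 1 η) (hR : ∀ z : E3, R < ‖z‖ → η z = 0)
    (hf : ContDiff ℝ 1 f) (hfc : HasCompactSupport f) (i j : Fin 3) (x : E3) :
    Integrable fun z : E3 ↦ (z i * (z j * (‖z‖ ^ 3)⁻¹)) •
      (bogovskiiWeight η (x - z) ‖z‖ (‖z‖⁻¹ • z) • fderiv ℝ f (x - z) +
        f (x - z) • ∫ s in Ioi ‖z‖, (s ^ 2) • fderiv ℝ η (s • (‖z‖⁻¹ • z) + (x - z))) := by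
  obtain ⟨C, D, -, hCD⟩ := exists_norm_derivIntegrand_le hη hR hf hfc i j ‖x‖
  exact (integrable_indicator_inv_norm C D).mono'
    (aestronglyMeasurable_of_continuousOn_compl_zero (continuousOn_derivIntegrand hη hR hf i j x))
    (ae_of_all _ fun z ↦ hCD x le_rfl z)

/-- **`S_η f` is differentiable, with derivative under the integral sign** (translated form): for `η, f ∈ C¹_c`,
`D(S_η f)^{ij}(x₀) = ∫ zᵢzⱼ/|z|³ ( w_{x₀−z} Df(x₀ − z) + f(x₀ − z) D_y w_{x₀−z} ) dz`.
[cite: MaoOhTao2023, Lemma 2.3] -/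
theorem hasFDerivAt_bogovskiiOperator (hη : ContDiff ℝ 1 η) (hR : ∀ z : E3, R < ‖z‖ → η z = 0)
    (hf : ContDiff ℝ 1 f) (hfc : HasCompactSupport f) (i j : Fin 3) (x₀ : E3) :
    HasFDerivAt (fun x : E3 ↦ ∫ y : E3, bogovskiiWeight η y ‖x - y‖ (‖x - y‖⁻¹ • (x - y)) *
        ((x - y) i * ((x - y) j * (‖x - y‖ ^ 3)⁻¹)) * f y)
      (∫ z : E3, (z i * (z j * (‖z‖ ^ 3)⁻¹)) •
        (bogovskiiWeight η (x₀ - z) ‖z‖ (‖z‖⁻¹ • z) • fderiv ℝ f (x₀ - z) +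
          f (x₀ - z) • ∫ s in Ioi ‖z‖, (s ^ 2) • fderiv ℝ η (s • (‖z‖⁻¹ • z) + (x₀ - z)))) x₀ := by
  have hηc : Continuous η := hη.continuous
  have hfcn : Continuous f := hf.continuous
  -- translated form, reassociated as `K(z) * (w * f)`
  set F : E3 → E3 → ℝ := fun x z ↦ (z i * (z j * (‖z‖ ^ 3)⁻¹)) *
    (bogovskiiWeight η (x - z) ‖z‖ (‖z‖⁻¹ • z) * f (x - z)) with hF
  set F' : E3 → E3 → (E3 →L[ℝ] ℝ) := fun x z ↦ (z i * (z j * (‖z‖ ^ 3)⁻¹)) •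
    (bogovskiiWeight η (x - z) ‖z‖ (‖z‖⁻¹ • z) • fderiv ℝ f (x - z) +
      f (x - z) • ∫ s in Ioi ‖z‖, (s ^ 2) • fderiv ℝ η (s • (‖z‖⁻¹ • z) + (x - z))) with hF'
  have hfun : (fun x : E3 ↦ ∫ y : E3, bogovskiiWeight η y ‖x - y‖ (‖x - y‖⁻¹ • (x - y)) *
      ((x - y) i * ((x - y) j * (‖x - y‖ ^ 3)⁻¹)) * f y) = fun x ↦ ∫ z, F x z := by
    funext x
    rw [bogovskiiOperator_eq_translated]
    refine integral_congr_ae (ae_of_all _ fun z ↦ ?_)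
    simp only [hF]
    ring
  rw [hfun]
  show HasFDerivAt (fun x ↦ ∫ z, F x z) (∫ z, F' x₀ z) x₀
  obtain ⟨C, D, -, hCD⟩ := exists_norm_derivIntegrand_le hη hR hf hfc i j (‖x₀‖ + 1)
  have hF_meas : ∀ᶠ x in 𝓝 x₀, AEStronglyMeasurable (F x) volume :=
    Eventually.of_forall fun x ↦ aestronglyMeasurable_of_continuousOn_compl_zero
      ((continuousOn_kernel i j).mul ((continuousOn_weight_translated hηc hR x).mul
        ((hfcn.comp (continuous_const.sub continuous_id)).continuousOn)))
  have hF_int : Integrable (F x₀) := by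
    refine (integrable_translated hηc hR hfcn hfc x₀ i j).congr (ae_of_all _ fun z ↦ ?_)
    simp only [hF]
    ring
  have hF'_meas : AEStronglyMeasurable (F' x₀) volume :=
    aestronglyMeasurable_of_continuousOn_compl_zero (continuousOn_derivIntegrand hη hR hf i j x₀)
  have h_bound : ∀ᵐ z ∂(volume : Measure E3), ∀ x ∈ ball x₀ 1,
      ‖F' x z‖ ≤ (closedBall (0 : E3) D).indicator (fun z ↦ C * ‖z‖⁻¹) z := by
    refine ae_of_all _ fun z x hx ↦ hCD x ?_ z
    rw [mem_ball, dist_eq_norm] at hx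
    have := norm_le_insert' x x₀
    linarith
  have h_diff : ∀ᵐ z ∂(volume : Measure E3), ∀ x ∈ ball x₀ 1, HasFDerivAt (F · z) (F' x z) x := by
    filter_upwards [compl_zero_mem_ae] with z hz
    intro x _
    have hn : 0 < ‖z‖ := norm_pos_iff.2 (mem_compl_singleton_iff.1 hz)
    have hα : ‖‖z‖⁻¹ • z‖ = 1 := by rw [norm_smul, norm_inv, norm_norm, inv_mul_cancel₀ hn.ne']
    have hsub : HasFDerivAt (fun x : E3 ↦ x - z) (ContinuousLinearMap.id ℝ E3) x := (hasFDerivAt_id x).sub_const z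
    have h1 : HasFDerivAt (fun x : E3 ↦ bogovskiiWeight η (x - z) ‖z‖ (‖z‖⁻¹ • z))
        (∫ s in Ioi ‖z‖, (s ^ 2) • fderiv ℝ η (s • (‖z‖⁻¹ • z) + (x - z))) x := by
      have h := (hasFDerivAt_bogovskiiWeight_base hη hR hα ‖z‖ (x - z)).comp x hsub
      rwa [ContinuousLinearMap.comp_id] at h
    have h2 : HasFDerivAt (fun x : E3 ↦ f (x - z)) (fderiv ℝ f (x - z)) x := by
      have h := ((hf.differentiable one_ne_zero) (x - z)).hasFDerivAt.comp x hsub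
      rwa [ContinuousLinearMap.comp_id] at h
    have h3 := (h1.mul h2).const_mul (z i * (z j * (‖z‖ ^ 3)⁻¹))
    simp only [hF, hF']
    exact h3
  exact hasFDerivAt_integral_of_dominated_of_fderiv_le (ball_mem_nhds x₀ one_pos) hF_meas hF_int hF'_meas h_bound
    (integrable_indicator_inv_norm C D) h_diff

/-- `S_η f` is differentiable for `η, f ∈ C¹_c`. [cite: MaoOhTao2023, Lemma 2.3] -/
theorem differentiable_bogovskiiOperator (hη : ContDiff ℝ 1 η) (hR : ∀ z : E3, R < ‖z‖ → η z = 0)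
    (hf : ContDiff ℝ 1 f) (hfc : HasCompactSupport f) (i j : Fin 3) :
    Differentiable ℝ fun x : E3 ↦ ∫ y : E3, bogovskiiWeight η y ‖x - y‖ (‖x - y‖⁻¹ • (x - y)) *
      ((x - y) i * ((x - y) j * (‖x - y‖ ^ 3)⁻¹)) * f y :=
  fun x ↦ (hasFDerivAt_bogovskiiOperator hη hR hf hfc i j x).differentiableAt

/-- The derivative `x ↦ D(S_η f)^{ij}(x)` is continuous. [folklore] -/
theorem continuous_integral_derivIntegrand (hη : ContDiff ℝ 1 η) (hR : ∀ z : E3, R < ‖z‖ → η z = 0)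
    (hf : ContDiff ℝ 1 f) (hfc : HasCompactSupport f) (i j : Fin 3) :
    Continuous fun x : E3 ↦ ∫ z : E3, (z i * (z j * (‖z‖ ^ 3)⁻¹)) •
      (bogovskiiWeight η (x - z) ‖z‖ (‖z‖⁻¹ • z) • fderiv ℝ f (x - z) +
        f (x - z) • ∫ s in Ioi ‖z‖, (s ^ 2) • fderiv ℝ η (s • (‖z‖⁻¹ • z) + (x - z))) := by
  refine continuous_iff_continuousAt.2 fun x₀ ↦ ?_
  obtain ⟨C, D, -, hCD⟩ := exists_norm_derivIntegrand_le hη hR hf hfc i j (‖x₀‖ + 1)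
  refine continuousAt_of_dominated (bound := fun z ↦ (closedBall (0 : E3) D).indicator (fun z ↦ C * ‖z‖⁻¹) z)
    (Eventually.of_forall fun x ↦ aestronglyMeasurable_of_continuousOn_compl_zero
      (continuousOn_derivIntegrand hη hR hf i j x)) ?_ (integrable_indicator_inv_norm C D) ?_
  · filter_upwards [Metric.ball_mem_nhds x₀ one_pos] with x hx
    refine ae_of_all _ fun z ↦ hCD x ?_ z
    rw [mem_ball, dist_eq_norm] at hx
    have := norm_le_insert' x x₀
    linarith
  · filter_upwards [compl_zero_mem_ae] with z hz
    exact (continuous_derivIntegrand_base hη hR hf i j (mem_compl_singleton_iff.1 hz)).continuousAt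

/-- **`S_η f ∈ C¹`** for `η, f ∈ C¹_c`. [cite: MaoOhTao2023, Lemma 2.3] -/
theorem contDiff_one_bogovskiiOperator (hη : ContDiff ℝ 1 η) (hR : ∀ z : E3, R < ‖z‖ → η z = 0)
    (hf : ContDiff ℝ 1 f) (hfc : HasCompactSupport f) (i j : Fin 3) :
    ContDiff ℝ 1 fun x : E3 ↦ ∫ y : E3, bogovskiiWeight η y ‖x - y‖ (‖x - y‖⁻¹ • (x - y)) *
      ((x - y) i * ((x - y) j * (‖x - y‖ ^ 3)⁻¹)) * f y := by
  refine contDiff_one_iff_fderiv.2 ⟨differentiable_bogovskiiOperator hη hR hf hfc i j, ?_⟩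
  have hfd : fderiv ℝ (fun x : E3 ↦ ∫ y : E3, bogovskiiWeight η y ‖x - y‖ (‖x - y‖⁻¹ • (x - y)) *
      ((x - y) i * ((x - y) j * (‖x - y‖ ^ 3)⁻¹)) * f y) = fun x ↦ ∫ z : E3, (z i * (z j * (‖z‖ ^ 3)⁻¹)) •
      (bogovskiiWeight η (x - z) ‖z‖ (‖z‖⁻¹ • z) • fderiv ℝ f (x - z) +
        f (x - z) • ∫ s in Ioi ‖z‖, (s ^ 2) • fderiv ℝ η (s • (‖z‖⁻¹ • z) + (x - z))) :=
    funext fun x ↦ (hasFDerivAt_bogovskiiOperator hη hR hf hfc i j x).fderiv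
  rw [hfd]
  exact continuous_integral_derivIntegrand hη hR hf hfc i j

/-- `∂_mη` is continuous and vanishes off `B̄_R` (so it is an admissible cut-off of one degree less). [folklore] -/
theorem continuous_pd_eta (hη : ContDiff ℝ 1 η) (m : Fin 3) : Continuous (pd m η) := by
  unfold pd
  exact (hη.continuous_fderiv one_ne_zero).clm_apply continuous_const

/-- **The partial derivatives of `S_η f`**: for `η, f ∈ C¹_c`,
`∂_m (S_η f)^{ij} = (S_{∂_mη} f)^{ij} + (S_η ∂_m f)^{ij}` — the derivative falls on the base point of the weight
(producing the same operator with cut-off `∂_mη`) and on `f`. [cite: MaoOhTao2023, Lemma 2.3] -/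
theorem pd_bogovskiiOperator (hη : ContDiff ℝ 1 η) (hR : ∀ z : E3, R < ‖z‖ → η z = 0)
    (hf : ContDiff ℝ 1 f) (hfc : HasCompactSupport f) (i j m : Fin 3) (x : E3) :
    pd m (fun x : E3 ↦ ∫ y : E3, bogovskiiWeight η y ‖x - y‖ (‖x - y‖⁻¹ • (x - y)) *
        ((x - y) i * ((x - y) j * (‖x - y‖ ^ 3)⁻¹)) * f y) x =
      (∫ y : E3, bogovskiiWeight (pd m η) y ‖x - y‖ (‖x - y‖⁻¹ • (x - y)) *
        ((x - y) i * ((x - y) j * (‖x - y‖ ^ 3)⁻¹)) * f y) +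
      ∫ y : E3, bogovskiiWeight η y ‖x - y‖ (‖x - y‖⁻¹ • (x - y)) *
        ((x - y) i * ((x - y) j * (‖x - y‖ ^ 3)⁻¹)) * pd m f y := by
  have hηc : Continuous η := hη.continuous
  have hfcn : Continuous f := hf.continuous
  have hpdf : Continuous (pd m f) := by
    unfold pd; exact (hf.continuous_fderiv one_ne_zero).clm_apply continuous_const
  have hpdfc : HasCompactSupport (pd m f) := by
    unfold pd; exact hfc.fderiv_apply (𝕜 := ℝ) (e m)
  have hpdη : Continuous (pd m η) := continuous_pd_eta hη m
  have hpdηR : ∀ z : E3, R < ‖z‖ → pd m η z = 0 := fun z hz ↦ pd_eq_zero_of_norm_lt hR m z hz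
  unfold pd
  rw [(hasFDerivAt_bogovskiiOperator hη hR hf hfc i j x).fderiv,
    ContinuousLinearMap.integral_apply (integrable_derivIntegrand hη hR hf hfc i j x) (e m)]
  -- evaluate the integrand at `e m` (off `z = 0`)
  have hev : (fun z : E3 ↦ ((z i * (z j * (‖z‖ ^ 3)⁻¹)) •
      (bogovskiiWeight η (x - z) ‖z‖ (‖z‖⁻¹ • z) • fderiv ℝ f (x - z) +
        f (x - z) • ∫ s in Ioi ‖z‖, (s ^ 2) • fderiv ℝ η (s • (‖z‖⁻¹ • z) + (x - z)))) (e m)) =ᵐ[volume]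
      fun z ↦ bogovskiiWeight (fun y ↦ fderiv ℝ η y (e m)) (x - z) ‖z‖ (‖z‖⁻¹ • z) *
          (z i * (z j * (‖z‖ ^ 3)⁻¹)) * f (x - z) +
        bogovskiiWeight η (x - z) ‖z‖ (‖z‖⁻¹ • z) * (z i * (z j * (‖z‖ ^ 3)⁻¹)) *
          fderiv ℝ f (x - z) (e m) := by
    filter_upwards [compl_zero_mem_ae] with z hz
    have hn : 0 < ‖z‖ := norm_pos_iff.2 (mem_compl_singleton_iff.1 hz)
    have hα : ‖‖z‖⁻¹ • z‖ = 1 := by rw [norm_smul, norm_inv, norm_norm, inv_mul_cancel₀ hn.ne']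
    simp only [FunLike.coe_smul, add_apply, Pi.smul_apply, smul_eq_mul]
    rw [fderivWeight_apply_e hη hR hα]
    unfold pd
    ring
  rw [integral_congr_ae hev]
  have hI1 := integrable_translated hpdη hpdηR hfcn hfc x i j
  have hI2 := integrable_translated hηc hR hpdf hpdfc x i j
  unfold pd at hI1 hI2
  rw [integral_add hI1 hI2, bogovskiiOperator_eq_translated, bogovskiiOperator_eq_translated]

end Regularity

end MaoOhTao

end Literature.Geometry.Lorentzian

end
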